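import Literature.Barriers.RiemannHypothesis.BettinGonek2017Proofs
import Literature.Barriers.RiemannHypothesis.BettinGonek2017Kernel
import Literature.NumberTheory.LFunctions.MoebiusRieszPerron
import Literature.NumberTheory.LFunctions.PerronTruncated
import Mathlib.Analysis.SpecialFunctions.ImproperIntegrals
import HarnessLib

/-!
# Bettin–Gonek 2017, Theorem 1 discharged: `H_t`, `J_t(x)` two ways, and the lower bound of §2

Last file of the discharge of `Literature.Barriers.RiemannHypothesis.BettinGonek2017_thm1`
(S. Bettin, S. M. Gonek, *The θ = ∞ conjecture implies the Riemann hypothesis*, Mathematika 63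
(2017) 29–33 = arXiv:1604.02740, Theorem 1), after `BettinGonek2017Proofs.lean`
(`levinsonMollifierLog`, the named fact `BettinGonek2017_lowerBound` and the endgame
`BettinGonek2017_thm1_of_lowerBound`) and `BettinGonek2017Kernel.lean` (the kernel `G_t` with
damping exponent `6`, `g_t`, `ratFun = G_t H_t`). It proves `BettinGonek2017_lowerBound_holds`,
hence `BettinGonek2017_thm1_holds`, following the printed §2 (p. 4). Everything is PROVED.

## Part 1 — `H_t` and the Mellin-convolution side of `J_t(x)`

Printed: "by Mellin inversion we see that `H_t(w) := ∫_1^∞ M_x(½+it)(log x) x^{-w} dx =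
1/((w−1)² ζ(w−½+it))` for `Re w > 3/2`", and, for `J_t(x) = (1/2πi)∫_(3) G_t(w)H_t(w)x^w dw`,
"by the convolution formula for products of Mellin transforms […]
`J_t(x) = ∫_1^∞ M_y(½+it)(log y) g_t(y/x) dy`. Thus […] `J_t(x) ≪ ∫_1^x |M_y(½+it)| log y dy`."

* `integral_levinsonMollifierLog_mul_cpow` — `H_t(w) = 1/((w−1)²ζ(w−½+it))`, here for
  `Re w ≥ 2` (all that is used), by termwise integration rather than Perron + Mellin inversion:
  `∫_n^∞ log(y/n) y^{-w} dy = n^{1−w}/(w−1)²` (`integral_logKernel`, an explicit primitive),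
  `∑_n ∫ = ∫ ∑_n` (`MeasureTheory.integral_tsum_of_summable_integral_norm`, the `L¹` norms being
  `≪ n^{½ − Re w}`), and `∑ μ(n) n^{-z} = 1/ζ(z)`
  (`Literature.NumberTheory.LFunctions.RieszPerron.LSeries_moebius_eq_inv`).
* `J ρ₀ t x = ∫ ratFun(3+iv) x^{3+iv} dv` (`= 2π · J_t(x)` of the paper, exponent `6`) and
  `J_eq_integral_kernelLine`: `J = ∫_1^∞ M_y(½+it) log y · k(3, x/y) dy` (Fubini on
  `ℝ × (1,∞)`, the integrand being dominated by `‖G_t(3+iv)‖x³ · ‖M_y log y‖ y^{-3}` with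
  `‖M_y log y‖ ≤ 2y^{3/2}`), whence `norm_J_le`: `‖J‖ ≤ 625π ∫_1^x |M_y(½+it)| log y dy`
  (`x ≥ 1`), using `k(3, x/y) = 0` for `y > x` and `‖k(3, x/y)‖ ≤ 625π` for `y ≤ x` from
  `BettinGonek2017Kernel.lean`.

## Part 2 — the residue side and the lower bound

Printed: "moving the line of integration in (def J) to `Re w = 0`, we see that
`J_t(x) = (1/2πi)∫_{(0)} G_t H_t x^w dw + x^{ρ₀+½−it}(ρ₀−1)/((3/2+ρ₀−it)²(ρ₀+3/2)⁴)`.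
The integral on the right is `O(1)` […] Thus […] `x^{β₀+½}/(1+|t|)² + 1 ≪ ∫_1^x |M_y(½+it)| log y dy`.
It follows from the Cauchy–Schwarz inequality that
`x^{2β₀}/(1+|t|)⁴ + 1/x ≪ ∫_1^x |M_y(½+it)|² log² y dy` for `x ≥ 2`."

* `J_eq_residue` — `J = ∫ ratFun(iv) x^{iv} dv + 2π φ(w₁)`, `w₁ = ρ₀ + ½ − it`,
  `φ(w) = (w−3/2+it)x^w/((w+1)²(w+1+it)⁶)` (so `φ(w₁)` is the printed residue with `⁶` for `⁴`):
  the line `Re w = 3` is moved to `Re w = 0` for the holomorphic function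
  `dslope φ w₁ + φ(w₁)/(w − w₁ + 3)`
  (`Literature.NumberTheory.LFunctions.MertensBoundRH.integral_vertical_eq_of_tendsto`), and
  the two simple fractions are integrated by
  `Literature.Analysis.Complex.VLI.integral_inv_sub_inv` (`−2π` on `Re w = 0`, `0` on `Re w = 3`).
* `norm_integral_ratFun_zero_le` (the `O(1)`: `≤ 2π`), `residueConst_mul_le_norm_phi`
  (`‖φ(w₁)‖ ≥ c₁(ρ₀) x^{β₀+½}/(1+|t|)²`, `c₁ = ‖ρ₀−1‖/‖ρ₀+3/2‖⁸`), `firstMoment_ineq`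
  (`c₁ x^{β₀+½}/(1+|t|)² ≤ (625/2)∫_1^x |M_y| log y dy + 1`, `x ≥ 1`).
* The "Cauchy–Schwarz" step is done by AM–GM (`integral_norm_le_amgm`, `sq_le_of_firstMoment`),
  together with `∫_1^x |M_y log y|² dy ≥ ∫_1^2 log² y dy > 0` (`M_y log y = log y` on `[1,2]`).
* `BettinGonek2017_lowerBound_holds`, `BettinGonek2017_thm1_holds`,
  `riemannHypothesis_of_mollifiedSecondMoment_bound` (the printed "in particular … RH"), and
  `MollifierLimitations_of_radziwill_inputs`: the barrier now rests on Radziwiłł's Prop. A,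
  Lemma 5 and Prop. B only.

## References

* [BettinGonek2017] S. Bettin, S. M. Gonek, Mathematika 63 (2017) 29–33; arXiv:1604.02740,
  Thm. 1 (p. 3) and §2 (p. 4: `H_t`, `J_t`, the Mellin-convolution display, the residue display,
  the `O(1)` and the two `≪` displays).
* [Radziwill2012] M. Radziwiłł, *Limitations to mollifying ζ(s)*, arXiv:1207.6583, §4.
-/

noncomputable section

open Complex MeasureTheory Set Filter Real
open scoped ArithmeticFunction.Moebius

namespace Literature.Barriers.RiemannHypothesis

namespace BettinGonek2017

/-! ## `∫_n^∞ log(y/n) y^{-w} dy = n^{1-w}/(w-1)²` -/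

/-- `log u ≤ 2 √u` for `u ≥ 0`. [folklore] -/
theorem log_le_two_mul_sqrt {u : ℝ} (hu : 0 ≤ u) : Real.log u ≤ 2 * u ^ (1 / 2 : ℝ) := by
  have := Real.log_le_rpow_div hu (by norm_num : (0 : ℝ) < 1 / 2)
  linarith

/-- The primitive `Φ(y) = −y^{1−w}((w−1) log(y/n) + 1)/(w−1)²` of `log(y/n) y^{−w}` (`y > 0`).
[folklore] -/
theorem hasDerivAt_logPrimitive {w : ℂ} (hw : w ≠ 1) {n : ℝ} (hn : 0 < n) {y : ℝ} (hy : 0 < y) :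
    HasDerivAt (fun y : ℝ ↦
        -((y : ℂ) ^ (1 - w) * ((w - 1) * (Real.log (y / n) : ℂ) + 1)) / (w - 1) ^ 2)
      ((Real.log (y / n) : ℂ) * (y : ℂ) ^ (-w)) y := by
  have hy0 : (y : ℂ) ≠ 0 := by exact_mod_cast hy.ne'
  -- derivative of `y ↦ y^{1-w}`
  have h1 : HasDerivAt (fun t : ℝ ↦ (t : ℂ) ^ (1 - w)) ((1 - w) * (y : ℂ) ^ (-w)) y := by
    have := ((hasDerivAt_id (y : ℂ)).cpow_const (c := 1 - w) (Or.inl (by exact_mod_cast hy)))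
    simp only [id, mul_one] at this
    rw [show (1 : ℂ) - w - 1 = -w by ring] at this
    exact this.comp_ofReal
  -- derivative of `y ↦ log(y/n)`
  have h2 : HasDerivAt (fun t : ℝ ↦ (Real.log (t / n) : ℂ)) ((1 / y : ℝ) : ℂ) y := by
    have h := ((hasDerivAt_id y).div_const n).log (ne_of_gt (div_pos hy hn))
    have : (1 : ℝ) / n / (id y / n) = 1 / y := by
      simp only [id]; field_simp
    rw [this] at h
    exact h.ofReal_comp
  have h3 : HasDerivAt (fun y : ℝ ↦
      -((y : ℂ) ^ (1 - w) * ((w - 1) * (Real.log (y / n) : ℂ) + 1)) / (w - 1) ^ 2)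
      (-((1 - w) * (y : ℂ) ^ (-w) * ((w - 1) * (Real.log (y / n) : ℂ) + 1) +
        (y : ℂ) ^ (1 - w) * ((w - 1) * ((1 / y : ℝ) : ℂ))) / (w - 1) ^ 2) y :=
    (h1.mul ((h2.const_mul (w - 1)).add_const 1)).neg.div_const ((w - 1) ^ 2)
  refine h3.congr_deriv ?_
  have hw1 : (w - 1) ^ 2 ≠ 0 := pow_ne_zero _ (sub_ne_zero.2 hw)
  have hyy : (y : ℂ) ^ (1 - w) = (y : ℂ) * (y : ℂ) ^ (-w) := by
    rw [show (1 : ℂ) - w = 1 + -w by ring, Complex.cpow_add _ _ hy0, Complex.cpow_one]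
  rw [hyy]
  push_cast
  field_simp
  ring

/-- Integrability of `log(y/n) y^{−w}` on `(n, ∞)` for `Re w ≥ 2`, `n ≥ 1`, with the majorant
`2 y^{1/2 − Re w}`. [folklore] -/
theorem integrableOn_logKernel {w : ℂ} (hw : 2 ≤ w.re) {n : ℝ} (hn : 1 ≤ n) :
    IntegrableOn (fun y : ℝ ↦ (Real.log (y / n) : ℂ) * (y : ℂ) ^ (-w)) (Ioi n) := by
  have hn0 : 0 < n := by linarith
  have hmaj : IntegrableOn (fun y : ℝ ↦ 2 * y ^ (1 / 2 - w.re)) (Ioi n) :=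
    ((integrableOn_Ioi_rpow_of_lt (by linarith) hn0).const_mul 2)
  refine hmaj.mono' ?_ ?_
  · refine ContinuousOn.aestronglyMeasurable (ContinuousOn.mul ?_ ?_) measurableSet_Ioi
    · exact continuous_ofReal.comp_continuousOn
        ((continuousOn_id.div_const n).log fun y hy ↦ (div_pos (hn0.trans hy) hn0).ne')
    · exact fun y hy ↦
        (Complex.continuousAt_ofReal_cpow_const y (-w) (Or.inr (hn0.trans hy).ne')).continuousWithinAt
  · refine (ae_restrict_mem measurableSet_Ioi).mono fun y hy ↦ ?_
    have hy0 : 0 < y := hn0.trans hy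
    have hlog0 : 0 ≤ Real.log (y / n) := Real.log_nonneg ((one_le_div hn0).2 hy.le)
    rw [norm_mul, Complex.norm_real, Real.norm_eq_abs, abs_of_nonneg hlog0,
      Complex.norm_cpow_eq_rpow_re_of_pos hy0, neg_re]
    have h1 : Real.log (y / n) ≤ 2 * y ^ (1 / 2 : ℝ) := by
      refine (log_le_two_mul_sqrt (div_pos hy0 hn0).le).trans ?_
      gcongr
      exact div_le_self hy0.le hn
    calc Real.log (y / n) * y ^ (-w.re) ≤ 2 * y ^ (1 / 2 : ℝ) * y ^ (-w.re) := by
          gcongr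
      _ = 2 * y ^ (1 / 2 - w.re) := by
          rw [mul_assoc, ← Real.rpow_add hy0]; ring_nf

/-- **`∫_n^∞ log(y/n) y^{−w} dy = n^{1−w}/(w−1)²`** for `Re w ≥ 2`, `n ≥ 1`. [folklore] -/
theorem integral_logKernel {w : ℂ} (hw : 2 ≤ w.re) {n : ℝ} (hn : 1 ≤ n) :
    ∫ y in Ioi n, (Real.log (y / n) : ℂ) * (y : ℂ) ^ (-w) = (n : ℂ) ^ (1 - w) / (w - 1) ^ 2 := by
  have hn0 : 0 < n := by linarith
  have hw1 : w ≠ 1 := by intro h; rw [h] at hw; norm_num at hw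
  set Φ : ℝ → ℂ := fun y ↦ -((y : ℂ) ^ (1 - w) * ((w - 1) * (Real.log (y / n) : ℂ) + 1)) / (w - 1) ^ 2
    with hΦ
  have hderiv : ∀ y ∈ Ioi n, HasDerivAt Φ ((Real.log (y / n) : ℂ) * (y : ℂ) ^ (-w)) y :=
    fun y hy ↦ hasDerivAt_logPrimitive hw1 hn0 (hn0.trans hy)
  have hcont : ContinuousWithinAt Φ (Ici n) n :=
    (hasDerivAt_logPrimitive hw1 hn0 hn0).continuousAt.continuousWithinAt
  have hlim : Tendsto Φ atTop (nhds 0) := by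
    rw [tendsto_zero_iff_norm_tendsto_zero]
    have hbound : ∀ y : ℝ, n ≤ y → ‖Φ y‖ ≤ (2 * ‖w - 1‖ + 1) / ‖w - 1‖ ^ 2 * y ^ (-(1 / 2 : ℝ)) := by
      intro y hy
      have hy0 : 0 < y := by linarith
      have hlog0 : 0 ≤ Real.log (y / n) := Real.log_nonneg ((one_le_div hn0).2 hy)
      have hlog : Real.log (y / n) ≤ 2 * y ^ (1 / 2 : ℝ) := by
        refine (log_le_two_mul_sqrt (div_pos hy0 hn0).le).trans ?_
        gcongr; exact div_le_self hy0.le hn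
      have hy1 : 1 ≤ y := hn.trans hy
      have hyhalf : 1 ≤ y ^ (1 / 2 : ℝ) := Real.one_le_rpow hy1 (by norm_num)
      rw [hΦ]
      simp only [norm_div, norm_neg, norm_mul, norm_pow, Complex.norm_cpow_eq_rpow_re_of_pos hy0,
        sub_re, one_re]
      have hin : ‖(w - 1) * (Real.log (y / n) : ℂ) + 1‖ ≤ (2 * ‖w - 1‖ + 1) * y ^ (1 / 2 : ℝ) := by
        calc ‖(w - 1) * (Real.log (y / n) : ℂ) + 1‖ ≤ ‖(w - 1) * (Real.log (y / n) : ℂ)‖ + ‖(1 : ℂ)‖ :=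
              norm_add_le _ _
          _ = ‖w - 1‖ * Real.log (y / n) + 1 := by
              rw [norm_mul, Complex.norm_real, Real.norm_eq_abs, abs_of_nonneg hlog0, norm_one]
          _ ≤ ‖w - 1‖ * (2 * y ^ (1 / 2 : ℝ)) + 1 * y ^ (1 / 2 : ℝ) :=
              add_le_add (mul_le_mul_of_nonneg_left hlog (norm_nonneg _)) (by simpa using hyhalf)
          _ = (2 * ‖w - 1‖ + 1) * y ^ (1 / 2 : ℝ) := by ring
      have hw0 : 0 < ‖w - 1‖ ^ 2 := pow_pos (norm_pos_iff.2 (sub_ne_zero.2 hw1)) 2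
      calc y ^ (1 - w.re) * ‖(w - 1) * (Real.log (y / n) : ℂ) + 1‖ / ‖w - 1‖ ^ 2
          ≤ y ^ (1 - w.re) * ((2 * ‖w - 1‖ + 1) * y ^ (1 / 2 : ℝ)) / ‖w - 1‖ ^ 2 := by gcongr
        _ = (2 * ‖w - 1‖ + 1) / ‖w - 1‖ ^ 2 * (y ^ (1 - w.re) * y ^ (1 / 2 : ℝ)) := by ring
        _ ≤ (2 * ‖w - 1‖ + 1) / ‖w - 1‖ ^ 2 * y ^ (-(1 / 2 : ℝ)) := by
            gcongr
            rw [← Real.rpow_add hy0]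
            exact Real.rpow_le_rpow_of_exponent_le hy1 (by linarith)
    have hlim0 : Tendsto (fun y : ℝ ↦ (2 * ‖w - 1‖ + 1) / ‖w - 1‖ ^ 2 * y ^ (-(1 / 2 : ℝ))) atTop
        (nhds 0) := by
      have := (tendsto_rpow_neg_atTop (by norm_num : (0 : ℝ) < 1 / 2)).const_mul
        ((2 * ‖w - 1‖ + 1) / ‖w - 1‖ ^ 2)
      simpa using this
    refine squeeze_zero' (Eventually.of_forall fun _ ↦ norm_nonneg _) ?_ hlim0
    exact (eventually_ge_atTop n).mono fun y hy ↦ hbound y hy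
  have := integral_Ioi_of_hasDerivAt_of_tendsto hcont hderiv (integrableOn_logKernel hw hn) hlim
  rw [this, hΦ]
  simp only [div_self hn0.ne', Real.log_one, Complex.ofReal_zero, mul_zero, zero_add, mul_one]
  ring

/-! ## The pieces `μ(n) n^{-s} log(y/n) y^{-w} 𝟙[n ≤ y]` and their integrals -/

/-- The `n`-th piece of `M_y(s) log y · y^{-w}`: `μ(n) n^{-s} log(y/n) y^{-w} 𝟙[n ≤ y]`
(zero for `n = 0` as `μ(0) = 0`). [cite: BettinGonek2017, §2] -/
def mellinPiece (s w : ℂ) (n : ℕ) (y : ℝ) : ℂ :=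
  if (n : ℝ) ≤ y then ((μ n : ℤ) : ℂ) * (n : ℂ) ^ (-s) * ((Real.log (y / n) : ℂ) * (y : ℂ) ^ (-w))
  else 0

/-- The piece `n = 0` vanishes. [cite: BettinGonek2017, §2] -/
theorem mellinPiece_zero (s w : ℂ) (y : ℝ) : mellinPiece s w 0 y = 0 := by
  simp [mellinPiece]

/-- `M_y(s) log y · y^{-w} = ∑_n` (pieces). [cite: BettinGonek2017, §2] -/
theorem tsum_mellinPiece (s w : ℂ) (y : ℝ) :
    ∑' n : ℕ, mellinPiece s w n y = levinsonMollifierLog y s * (y : ℂ) ^ (-w) := by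
  rw [tsum_eq_sum (s := Finset.Icc 1 ⌊y⌋₊)]
  · rw [levinsonMollifierLog, Finset.sum_mul]
    refine Finset.sum_congr rfl fun n hn ↦ ?_
    obtain ⟨hn1, hnK⟩ := Finset.mem_Icc.1 hn
    have hy : 0 ≤ y := by
      by_contra h; rw [Nat.floor_of_nonpos (not_le.1 h).le] at hnK; omega
    have hny : (n : ℝ) ≤ y := (Nat.le_floor_iff hy).1 hnK
    simp only [mellinPiece, if_pos hny]; ring
  · intro n hn
    rcases Nat.eq_zero_or_pos n with h0 | h0
    · subst h0; exact mellinPiece_zero s w y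
    · simp only [mellinPiece]
      rw [if_neg]
      intro hny
      have hy : 0 ≤ y := le_trans (by positivity) hny
      exact hn (Finset.mem_Icc.2 ⟨h0, (Nat.le_floor_iff hy).2 hny⟩)

/-- The piece as an indicator of `[n, ∞)`. [cite: BettinGonek2017, §2] -/
theorem mellinPiece_eq_indicator (s w : ℂ) (n : ℕ) :
    mellinPiece s w n = (Ici (n : ℝ)).indicator fun y : ℝ ↦
      ((μ n : ℤ) : ℂ) * (n : ℂ) ^ (-s) * ((Real.log (y / n) : ℂ) * (y : ℂ) ^ (-w)) := by
  funext y
  simp only [mellinPiece, Set.indicator_apply, mem_Ici]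

/-- `(1, ∞) ∩ [n, ∞)` is `(1, ∞)` for `n = 1` and `[n, ∞)` for `n ≥ 2`; in both cases its
integrals are those over `(n, ∞)`. [folklore] -/
theorem setIntegral_Ioi_inter_Ici {n : ℕ} (hn : 1 ≤ n) (f : ℝ → ℂ) :
    ∫ y in Ioi (1 : ℝ) ∩ Ici (n : ℝ), f y = ∫ y in Ioi (n : ℝ), f y := by
  rcases eq_or_lt_of_le hn with h1 | h1
  · subst h1
    rw [Nat.cast_one, Set.inter_eq_left.2 Ioi_subset_Ici_self]
  · have : Ioi (1 : ℝ) ∩ Ici (n : ℝ) = Ici (n : ℝ) :=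
      Set.inter_eq_right.2 fun y hy ↦ show (1 : ℝ) < y from lt_of_lt_of_le (by exact_mod_cast h1) hy
    rw [this, integral_Ici_eq_integral_Ioi]

/-- Real-valued version of `setIntegral_Ioi_inter_Ici`. [folklore] -/
theorem setIntegral_Ioi_inter_Ici_real {n : ℕ} (hn : 1 ≤ n) (f : ℝ → ℝ) :
    ∫ y in Ioi (1 : ℝ) ∩ Ici (n : ℝ), f y = ∫ y in Ioi (n : ℝ), f y := by
  rcases eq_or_lt_of_le hn with h1 | h1
  · subst h1
    rw [Nat.cast_one, Set.inter_eq_left.2 Ioi_subset_Ici_self]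
  · have : Ioi (1 : ℝ) ∩ Ici (n : ℝ) = Ici (n : ℝ) :=
      Set.inter_eq_right.2 fun y hy ↦ show (1 : ℝ) < y from lt_of_lt_of_le (by exact_mod_cast h1) hy
    rw [this, integral_Ici_eq_integral_Ioi]

/-- Each piece is integrable on `(1, ∞)` (`Re w ≥ 2`). [cite: BettinGonek2017, §2] -/
theorem integrable_mellinPiece (s : ℂ) {w : ℂ} (hw : 2 ≤ w.re) (n : ℕ) :
    Integrable (mellinPiece s w n) (volume.restrict (Ioi 1)) := by
  rcases Nat.eq_zero_or_pos n with h0 | h0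
  · subst h0
    have : mellinPiece s w 0 = fun _ ↦ 0 := funext (mellinPiece_zero s w)
    rw [this]; exact integrable_zero _ _ _
  rw [mellinPiece_eq_indicator]
  refine (IntegrableOn.integrable_indicator ?_ measurableSet_Ici).restrict
  rw [integrableOn_Ici_iff_integrableOn_Ioi]
  exact (integrableOn_logKernel hw (by exact_mod_cast h0)).const_mul _

/-- **The integral of a piece**: `∫_1^∞ μ(n) n^{-s} log(y/n) y^{-w} 𝟙[n ≤ y] dy =
μ(n) n^{-s} n^{1−w}/(w−1)²` (`n ≥ 1`, `Re w ≥ 2`). [cite: BettinGonek2017, §2] -/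
theorem integral_mellinPiece (s : ℂ) {w : ℂ} (hw : 2 ≤ w.re) {n : ℕ} (hn : 1 ≤ n) :
    ∫ y in Ioi (1 : ℝ), mellinPiece s w n y =
      ((μ n : ℤ) : ℂ) * (n : ℂ) ^ (-s) * ((n : ℂ) ^ (1 - w) / (w - 1) ^ 2) := by
  rw [mellinPiece_eq_indicator, setIntegral_indicator measurableSet_Ici,
    setIntegral_Ioi_inter_Ici hn, integral_const_mul, integral_logKernel hw (by exact_mod_cast hn)]
  push_cast
  ring

/-- Norm bound for a piece: `‖piece_n(y)‖ ≤ 2 n^{-1} y^{1/2 − Re w} 𝟙[n ≤ y]` on `y > 1`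
(`n ≥ 1`). [cite: BettinGonek2017, §2] -/
theorem norm_mellinPiece_le {s : ℂ} (hs : s.re = 1 / 2) (w : ℂ) {n : ℕ} (hn : 1 ≤ n) {y : ℝ}
    (hy : 0 < y) :
    ‖mellinPiece s w n y‖ ≤
      (Ici (n : ℝ)).indicator (fun y : ℝ ↦ 2 * (n : ℝ)⁻¹ * y ^ (1 / 2 - w.re)) y := by
  have hn0 : (0 : ℝ) < n := by exact_mod_cast hn
  simp only [mellinPiece, Set.indicator_apply, mem_Ici]
  split_ifs with hny
  · have hlog0 : 0 ≤ Real.log (y / n) := Real.log_nonneg ((one_le_div hn0).2 hny)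
    rw [norm_mul, norm_mul, norm_mul, Complex.norm_intCast, Complex.norm_natCast_cpow_of_pos
      (by omega), Complex.norm_real, Real.norm_eq_abs, abs_of_nonneg hlog0,
      Complex.norm_cpow_eq_rpow_re_of_pos hy, neg_re, neg_re, hs]
    have h1 : |(μ n : ℝ)| ≤ 1 := by exact_mod_cast ArithmeticFunction.abs_moebius_le_one
    have h2 : Real.log (y / n) ≤ 2 * (y ^ (1 / 2 : ℝ) * (n : ℝ) ^ (-(1 / 2 : ℝ))) := by
      refine (log_le_two_mul_sqrt (div_pos hy hn0).le).trans (le_of_eq ?_)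
      rw [Real.div_rpow hy.le hn0.le, Real.rpow_neg hn0.le, div_eq_mul_inv]
    calc |(μ n : ℝ)| * (n : ℝ) ^ (-(1 / 2 : ℝ)) * (Real.log (y / n) * y ^ (-w.re))
        ≤ 1 * (n : ℝ) ^ (-(1 / 2 : ℝ)) * (2 * (y ^ (1 / 2 : ℝ) * (n : ℝ) ^ (-(1 / 2 : ℝ))) * y ^ (-w.re)) := by
          gcongr
      _ = 2 * ((n : ℝ) ^ (-(1 / 2 : ℝ)) * (n : ℝ) ^ (-(1 / 2 : ℝ))) * (y ^ (1 / 2 : ℝ) * y ^ (-w.re)) := by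
          ring
      _ = 2 * (n : ℝ)⁻¹ * y ^ (1 / 2 - w.re) := by
          rw [← Real.rpow_add hn0, ← Real.rpow_add hy, show -(1 / 2 : ℝ) + -(1 / 2) = -1 by norm_num,
            Real.rpow_neg_one, sub_eq_add_neg]
  · simp

/-- The `L¹` norms of the pieces: `∫_1^∞ ‖piece_n‖ ≤ (2/(Re w − 3/2)) n^{1/2 − Re w}` (`n ≥ 1`,
`Re w ≥ 2`). [cite: BettinGonek2017, §2] -/
theorem integral_norm_mellinPiece_le {s : ℂ} (hs : s.re = 1 / 2) {w : ℂ} (hw : 2 ≤ w.re) {n : ℕ}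
    (hn : 1 ≤ n) :
    ∫ y in Ioi (1 : ℝ), ‖mellinPiece s w n y‖ ≤ 2 / (w.re - 3 / 2) * (n : ℝ) ^ (1 / 2 - w.re) := by
  have hn0 : (0 : ℝ) < n := by exact_mod_cast hn
  have hexp : 1 / 2 - w.re < -1 := by linarith
  have hmajI : IntegrableOn (fun y : ℝ ↦ 2 * (n : ℝ)⁻¹ * y ^ (1 / 2 - w.re)) (Ioi (n : ℝ)) :=
    (integrableOn_Ioi_rpow_of_lt hexp hn0).const_mul _
  have hmaj : Integrable ((Ici (n : ℝ)).indicator fun y : ℝ ↦ 2 * (n : ℝ)⁻¹ * y ^ (1 / 2 - w.re))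
      (volume.restrict (Ioi 1)) :=
    (IntegrableOn.integrable_indicator (by rw [integrableOn_Ici_iff_integrableOn_Ioi]; exact hmajI)
      measurableSet_Ici).restrict
  calc ∫ y in Ioi (1 : ℝ), ‖mellinPiece s w n y‖
      ≤ ∫ y in Ioi (1 : ℝ), (Ici (n : ℝ)).indicator
          (fun y : ℝ ↦ 2 * (n : ℝ)⁻¹ * y ^ (1 / 2 - w.re)) y := by
        refine integral_mono_ae (integrable_mellinPiece s hw n).norm hmaj ?_
        exact (ae_restrict_mem measurableSet_Ioi).mono fun y hy ↦
          norm_mellinPiece_le hs w hn (lt_trans one_pos hy)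
    _ = 2 * (n : ℝ)⁻¹ * ∫ y in Ioi (n : ℝ), y ^ (1 / 2 - w.re) := by
        rw [integral_indicator measurableSet_Ici, Measure.restrict_restrict measurableSet_Ici,
          Set.inter_comm, setIntegral_Ioi_inter_Ici_real hn, integral_const_mul]
    _ = 2 / (w.re - 3 / 2) * (n : ℝ) ^ (1 / 2 - w.re) := by
        rw [integral_Ioi_rpow_of_lt hexp hn0, Real.rpow_add_one hn0.ne']
        have hne : w.re - 3 / 2 ≠ 0 := by intro h; linarith
        have h' : 1 / 2 - w.re + 1 = -(w.re - 3 / 2) := by ring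
        rw [h']
        field_simp

/-- The `L¹` norms of the pieces are summable (`Re w ≥ 2`). [cite: BettinGonek2017, §2] -/
theorem summable_integral_norm_mellinPiece {s : ℂ} (hs : s.re = 1 / 2) {w : ℂ} (hw : 2 ≤ w.re) :
    Summable fun n : ℕ ↦ ∫ y in Ioi (1 : ℝ), ‖mellinPiece s w n y‖ := by
  have hp : 1 / 2 - w.re < -1 := by linarith
  refine Summable.of_nonneg_of_le (fun n ↦ integral_nonneg fun _ ↦ norm_nonneg _)
    (fun n ↦ ?_) ((Real.summable_nat_rpow.2 hp).mul_left (2 / (w.re - 3 / 2)))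
  rcases Nat.eq_zero_or_pos n with h0 | h0
  · subst h0
    have : (0 : ℝ) ^ (1 / 2 - w.re) = 0 := Real.zero_rpow (by intro h; linarith)
    simp only [mellinPiece_zero, norm_zero, integral_zero, Nat.cast_zero]
    rw [this, mul_zero]
  · exact integral_norm_mellinPiece_le hs hw h0

/-- **The Mellin transform of `y ↦ M_y(½+it) log y`** (Bettin–Gonek's `H_t(w)`): for `Re w ≥ 2`,
`∫_1^∞ M_y(½+it) log y · y^{-w} dy = 1/((w−1)² ζ(w − ½ + it))`. Printed for `Re w > 3/2` via
Perron's formula and Mellin inversion; here by integrating termwise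
(`∫_n^∞ log(y/n) y^{-w} dy = n^{1−w}/(w−1)²`) and `∑ μ(n) n^{-z} = 1/ζ(z)`.
[cite: BettinGonek2017, §2] -/
theorem integral_levinsonMollifierLog_mul_cpow (t : ℝ) {w : ℂ} (hw : 2 ≤ w.re) :
    ∫ y in Ioi (1 : ℝ), levinsonMollifierLog y (1 / 2 + t * I) * (y : ℂ) ^ (-w) =
      (riemannZeta (w - 1 / 2 + t * I))⁻¹ / (w - 1) ^ 2 := by
  set s : ℂ := 1 / 2 + t * I with hs_def
  have hs : s.re = 1 / 2 := by simp [hs_def]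
  set z : ℂ := w - 1 / 2 + t * I with hz_def
  have hz : 1 < z.re := by simp [hz_def]; linarith
  calc ∫ y in Ioi (1 : ℝ), levinsonMollifierLog y s * (y : ℂ) ^ (-w)
      = ∫ y in Ioi (1 : ℝ), ∑' n : ℕ, mellinPiece s w n y :=
        setIntegral_congr_fun measurableSet_Ioi fun y _ ↦ (tsum_mellinPiece s w y).symm
    _ = ∑' n : ℕ, ∫ y in Ioi (1 : ℝ), mellinPiece s w n y :=
        (integral_tsum_of_summable_integral_norm (integrable_mellinPiece s hw)
          (summable_integral_norm_mellinPiece hs hw)).symm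
    _ = ∑' n : ℕ, LSeries.term (fun n ↦ ((μ n : ℤ) : ℂ)) z n / (w - 1) ^ 2 := by
        refine tsum_congr fun n ↦ ?_
        rcases Nat.eq_zero_or_pos n with h0 | h0
        · subst h0; simp [mellinPiece_zero, LSeries.term]
        · rw [integral_mellinPiece s hw h0, LSeries.term_of_ne_zero h0.ne']
          have hn0 : (n : ℂ) ≠ 0 := by exact_mod_cast h0.ne'
          have key : (n : ℂ) ^ (-s) * (n : ℂ) ^ (1 - w) = ((n : ℂ) ^ z)⁻¹ := by
            rw [← Complex.cpow_add _ _ hn0, ← Complex.cpow_neg]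
            congr 1
            rw [hs_def, hz_def]; ring
          calc ((μ n : ℤ) : ℂ) * (n : ℂ) ^ (-s) * ((n : ℂ) ^ (1 - w) / (w - 1) ^ 2)
              = ((μ n : ℤ) : ℂ) * ((n : ℂ) ^ (-s) * (n : ℂ) ^ (1 - w)) / (w - 1) ^ 2 := by ring
            _ = ((μ n : ℤ) : ℂ) / (n : ℂ) ^ z / (w - 1) ^ 2 := by
                rw [key, div_eq_mul_inv, div_eq_mul_inv, div_eq_mul_inv]
    _ = (∑' n : ℕ, LSeries.term (fun n ↦ ((μ n : ℤ) : ℂ)) z n) / (w - 1) ^ 2 := tsum_div_const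
    _ = (riemannZeta z)⁻¹ / (w - 1) ^ 2 := by
        rw [← LSeries, Literature.NumberTheory.LFunctions.RieszPerron.LSeries_moebius_eq_inv hz]

/-! ## `J_t(x)` by Mellin convolution (Fubini) -/

/-- `‖M_y(s) log y‖ ≤ 2 y^{3/2}` for `y > 0`, `Re s ≥ 0`. [cite: BettinGonek2017, §2] -/
theorem norm_levinsonMollifierLog_le_rpow {s : ℂ} (hs : 0 ≤ s.re) {y : ℝ} (hy : 0 < y) :
    ‖levinsonMollifierLog y s‖ ≤ 2 * y ^ (3 / 2 : ℝ) := by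
  rcases lt_or_ge y 1 with h1 | h1
  · rw [levinsonMollifierLog_of_lt_one h1]; simp only [norm_zero]; positivity
  · calc ‖levinsonMollifierLog y s‖ ≤ ⌊y⌋₊ * Real.log y := norm_levinsonMollifierLog_le hs y
      _ ≤ y * (2 * y ^ (1 / 2 : ℝ)) := by
          gcongr
          · exact Real.log_nonneg h1
          · exact Nat.floor_le hy.le
          · exact log_le_two_mul_sqrt hy.le
      _ = 2 * y ^ (3 / 2 : ℝ) := by
          rw [show (3 / 2 : ℝ) = 1 + 1 / 2 by norm_num, Real.rpow_add hy, Real.rpow_one]; ring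

/-- `y ↦ ‖M_y(s) log y‖ y^{-3}` is integrable on `(1, ∞)` (`Re s ≥ 0`). [cite: BettinGonek2017, §2] -/
theorem integrable_norm_levinsonMollifierLog_mul_rpow {s : ℂ} (hs : 0 ≤ s.re) :
    Integrable (fun y : ℝ ↦ ‖levinsonMollifierLog y s‖ * y ^ (-(3 : ℝ)))
      (volume.restrict (Ioi 1)) := by
  have hmaj : IntegrableOn (fun y : ℝ ↦ 2 * y ^ (-(3 / 2 : ℝ))) (Ioi (1 : ℝ)) :=
    (integrableOn_Ioi_rpow_of_lt (by norm_num) one_pos).const_mul 2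
  refine hmaj.mono' ?_ ?_
  · exact (((measurable_levinsonMollifierLog s).norm).mul
      (measurable_id.pow_const _)).aestronglyMeasurable
  · refine (ae_restrict_mem measurableSet_Ioi).mono fun y hy ↦ ?_
    have hy0 : 0 < y := lt_trans one_pos hy
    rw [Real.norm_eq_abs, abs_of_nonneg (by positivity)]
    calc ‖levinsonMollifierLog y s‖ * y ^ (-(3 : ℝ)) ≤ 2 * y ^ (3 / 2 : ℝ) * y ^ (-(3 : ℝ)) := by
          gcongr; exact norm_levinsonMollifierLog_le_rpow hs hy0
      _ = 2 * y ^ (-(3 / 2 : ℝ)) := by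
          rw [mul_assoc, ← Real.rpow_add hy0]; norm_num

/-- The two-variable integrand of `J_t(x)`:
`(v, y) ↦ G_t(3+iv) x^{3+iv} · M_y(½+it) log y · y^{-(3+iv)}`. [cite: BettinGonek2017, §2] -/
def fubiniIntegrand (ρ₀ : ℂ) (t x : ℝ) (v y : ℝ) : ℂ :=
  kernel ρ₀ t (3 + v * I) * (x : ℂ) ^ ((3 : ℂ) + v * I) *
    (levinsonMollifierLog y (1 / 2 + t * I) * (y : ℂ) ^ (-((3 : ℂ) + v * I)))

/-- The integrand of `J_t(x)` is (jointly) measurable. [cite: BettinGonek2017, §2] -/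
theorem measurable_fubiniIntegrand (ρ₀ : ℂ) (t : ℝ) {x : ℝ} (hx : 0 < x) :
    Measurable (Function.uncurry (fubiniIntegrand ρ₀ t x)) := by
  unfold fubiniIntegrand Function.uncurry
  refine Measurable.mul (Measurable.mul ?_ ?_) (Measurable.mul ?_ ?_)
  · exact (continuous_kernel_line ρ₀ t (by norm_num : (-1 : ℝ) < 3)).measurable.comp measurable_fst
  · exact (continuous_cpow_line hx 3).measurable.comp measurable_fst
  · exact (measurable_levinsonMollifierLog _).comp measurable_snd
  · exact (Complex.measurable_ofReal.comp measurable_snd).pow (by fun_prop)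

/-- Almost every point of `ℝ × (1, ∞)` (product of Lebesgue measure with its restriction) has second
coordinate `> 1`. [folklore] -/
theorem ae_snd_mem_Ioi :
    ∀ᵐ p : ℝ × ℝ ∂((volume : Measure ℝ).prod (volume.restrict (Ioi 1))), p.2 ∈ Ioi (1 : ℝ) := by
  have : (volume : Measure ℝ).prod (volume.restrict (Ioi (1 : ℝ))) =
      ((volume : Measure ℝ).prod volume).restrict (univ ×ˢ Ioi 1) := by
    rw [← Measure.prod_restrict, Measure.restrict_univ]
  rw [this]
  filter_upwards [ae_restrict_mem (MeasurableSet.univ.prod measurableSet_Ioi)] with p hp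
  exact hp.2

/-- The integrand of `J_t(x)` is integrable on `ℝ × (1, ∞)`. [cite: BettinGonek2017, §2] -/
theorem integrable_fubiniIntegrand {ρ₀ : ℂ} (hζ : riemannZeta ρ₀ = 0) (hβ : 1 / 2 ≤ ρ₀.re)
    (t : ℝ) {x : ℝ} (hx : 0 < x) :
    Integrable (Function.uncurry (fubiniIntegrand ρ₀ t x))
      ((volume : Measure ℝ).prod (volume.restrict (Ioi 1))) := by
  set s : ℂ := 1 / 2 + t * I with hs_def
  have hs : 0 ≤ s.re := by simp [hs_def]
  have hf : Integrable (fun v : ℝ ↦ kernel ρ₀ t (3 + v * I) * (x : ℂ) ^ ((3 : ℂ) + v * I)) := by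
    have := integrable_kernel_line hζ hβ t (σ := 3) (by norm_num) hx
    simpa using this
  have hF : Integrable (fun p : ℝ × ℝ ↦ ‖kernel ρ₀ t (3 + p.1 * I) * (x : ℂ) ^ ((3 : ℂ) + p.1 * I)‖ *
      (‖levinsonMollifierLog p.2 s‖ * p.2 ^ (-(3 : ℝ))))
      ((volume : Measure ℝ).prod (volume.restrict (Ioi 1))) :=
    hf.norm.mul_prod (integrable_norm_levinsonMollifierLog_mul_rpow hs)
  refine hF.mono' (measurable_fubiniIntegrand ρ₀ t hx).aestronglyMeasurable ?_
  filter_upwards [ae_snd_mem_Ioi] with p hp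
  have hy0 : 0 < p.2 := lt_trans one_pos hp
  simp only [Function.uncurry, fubiniIntegrand]
  rw [norm_mul, norm_mul (levinsonMollifierLog p.2 s), Complex.norm_cpow_eq_rpow_re_of_pos hy0]
  simp

/-- **Bettin–Gonek's `J_t(x)`** (times `2π`; with our exponent `6`):
`J_t(x) = ∫_{Re w = 3} G_t(w) H_t(w) x^w |dw| = ∫ ratFun(3+iv) x^{3+iv} dv`.
[cite: BettinGonek2017, §2] -/
def J (ρ₀ : ℂ) (t x : ℝ) : ℂ :=
  ∫ v : ℝ, ratFun ρ₀ t (3 + v * I) * (x : ℂ) ^ ((3 : ℂ) + v * I)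

/-- The inner `y`-integral: `∫_1^∞ G x^w M_y log y · y^{-w} dy = G_t(w) H_t(w) x^w = ratFun(w) x^w`
on `Re w = 3`. [cite: BettinGonek2017, §2] -/
theorem integral_fubiniIntegrand_right {ρ₀ : ℂ} (hζ : riemannZeta ρ₀ = 0) (t : ℝ) (x : ℝ)
    (v : ℝ) :
    ∫ y in Ioi (1 : ℝ), fubiniIntegrand ρ₀ t x v y =
      ratFun ρ₀ t (3 + v * I) * (x : ℂ) ^ ((3 : ℂ) + v * I) := by
  unfold fubiniIntegrand
  rw [integral_const_mul, integral_levinsonMollifierLog_mul_cpow t (w := 3 + v * I) (by norm_num),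
    ← kernel_mul_inv_eq_ratFun hζ (t := t) (w := 3 + v * I) (by norm_num)]
  ring

/-- The inner `v`-integral: `∫ G_t(3+iv) x^{3+iv} M_y log y · y^{-(3+iv)} dv = M_y log y · k(3, x/y)`
(`x, y > 0`). [cite: BettinGonek2017, §2] -/
theorem integral_fubiniIntegrand_left (ρ₀ : ℂ) (t : ℝ) {x y : ℝ} (hx : 0 < x) (hy : 0 < y) :
    ∫ v : ℝ, fubiniIntegrand ρ₀ t x v y =
      levinsonMollifierLog y (1 / 2 + t * I) * kernelLine ρ₀ t 3 (x / y) := by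
  unfold fubiniIntegrand kernelLine
  rw [← integral_const_mul]
  refine integral_congr_ae (Eventually.of_forall fun v ↦ ?_)
  have h3 : ((3 : ℝ) : ℂ) + v * I = (3 : ℂ) + v * I := by push_cast; ring
  simp only [h3]
  rw [Literature.NumberTheory.LFunctions.ofReal_div_cpow hx.le hy, Complex.cpow_neg]
  ring

/-- **`J_t(x)` as a Mellin convolution** (Fubini):
`J_t(x) = ∫_1^∞ M_y(½+it) log y · k(3, x/y) dy`. [cite: BettinGonek2017, §2] -/
theorem J_eq_integral_kernelLine {ρ₀ : ℂ} (hζ : riemannZeta ρ₀ = 0) (hβ : 1 / 2 ≤ ρ₀.re)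
    (t : ℝ) {x : ℝ} (hx : 0 < x) :
    J ρ₀ t x = ∫ y in Ioi (1 : ℝ),
      levinsonMollifierLog y (1 / 2 + t * I) * kernelLine ρ₀ t 3 (x / y) := by
  calc J ρ₀ t x = ∫ v : ℝ, ∫ y in Ioi (1 : ℝ), fubiniIntegrand ρ₀ t x v y := by
        unfold J
        exact integral_congr_ae (Eventually.of_forall fun v ↦
          (integral_fubiniIntegrand_right hζ t x v).symm)
    _ = ∫ y in Ioi (1 : ℝ), ∫ v : ℝ, fubiniIntegrand ρ₀ t x v y :=
        integral_integral_swap (integrable_fubiniIntegrand hζ hβ t hx)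
    _ = ∫ y in Ioi (1 : ℝ), levinsonMollifierLog y (1 / 2 + t * I) * kernelLine ρ₀ t 3 (x / y) :=
        setIntegral_congr_fun measurableSet_Ioi fun y hy ↦
          integral_fubiniIntegrand_left ρ₀ t hx (lt_trans one_pos hy)

/-- **The Mellin-side bound for `J_t(x)`**: `‖J_t(x)‖ ≤ 625π ∫_1^x |M_y(½+it)| log y dy`
(`x ≥ 1`; `k(3, x/y) = 0` for `y > x` and `‖k(3, x/y)‖ ≤ 625π` for `y ≤ x`).
[cite: BettinGonek2017, §2] -/
theorem norm_J_le {ρ₀ : ℂ} (hζ : riemannZeta ρ₀ = 0) (hβ : 1 / 2 ≤ ρ₀.re) (t : ℝ) {x : ℝ}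
    (hx : 1 ≤ x) :
    ‖J ρ₀ t x‖ ≤ 625 * π * ∫ y in (1 : ℝ)..x, ‖levinsonMollifierLog y (1 / 2 + t * I)‖ := by
  have hx0 : 0 < x := by linarith
  set s : ℂ := 1 / 2 + t * I with hs_def
  have hs : 0 ≤ s.re := by simp [hs_def]
  rw [J_eq_integral_kernelLine hζ hβ t hx0,
    setIntegral_eq_of_subset_of_forall_sdiff_eq_zero (s := Ioc 1 x) measurableSet_Ioi
      Ioc_subset_Ioi_self ?_, intervalIntegral.integral_of_le hx, ← integral_const_mul]
  · refine norm_integral_le_of_norm_le ?_ ?_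
    · refine Integrable.const_mul ?_ _
      refine Measure.integrableOn_of_bounded (M := x ^ 2) measure_Ioc_lt_top.ne
        ((measurable_levinsonMollifierLog s).norm).aestronglyMeasurable ?_
      refine (ae_restrict_mem measurableSet_Ioc).mono fun y hy ↦ ?_
      rw [norm_norm]
      calc ‖levinsonMollifierLog y s‖ ≤ y ^ 2 := norm_levinsonMollifierLog_le_sq hs y
        _ ≤ x ^ 2 := by gcongr <;> linarith [hy.1, hy.2]
    · refine (ae_restrict_mem measurableSet_Ioc).mono fun y hy ↦ ?_
      have hy0 : 0 < y := lt_trans one_pos hy.1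
      rw [norm_mul, mul_comm (625 * π)]
      gcongr
      exact norm_kernelLine_three_le hζ hβ t ((one_le_div hy0).2 hy.2)
  · intro y hy
    obtain ⟨hy1, hy2⟩ := hy
    have hyx : x < y := by
      by_contra h
      exact hy2 ⟨hy1, not_lt.1 h⟩
    have hy0 : 0 < y := lt_trans one_pos hy1
    rw [kernelLine_three_eq_zero hζ hβ t (div_pos hx0 hy0) ((div_lt_one hy0).2 hyx), mul_zero]


/-! ## The pole `w₁ = ρ₀ + ½ − it` and the residue -/

/-- The pole `w₁ = ρ₀ + ½ − it` of `G_t H_t` (where `w − ½ + it = ρ₀`). [cite: BettinGonek2017, §2] -/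
def pole (ρ₀ : ℂ) (t : ℝ) : ℂ := ρ₀ + 1 / 2 - t * I

/-- `φ(w) = (w − 3/2 + it) x^w/((w+1)²(w+1+it)⁶)`, the holomorphic part: `ratFun(w) x^w = φ(w)/(w − w₁)`;
`φ(w₁) = x^{ρ₀+½−it}(ρ₀−1)/((ρ₀+3/2−it)²(ρ₀+3/2)⁶)` is the residue. [cite: BettinGonek2017, §2] -/
def phi (t x : ℝ) (w : ℂ) : ℂ :=
  (w - 3 / 2 + t * I) * (x : ℂ) ^ w / ((w + 1) ^ 2 * (w + 1 + t * I) ^ 6)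

/-- `ratFun(w) x^w = φ(w)/(w − w₁)`. [cite: BettinGonek2017, §2] -/
theorem ratFun_mul_cpow (ρ₀ : ℂ) (t x : ℝ) (w : ℂ) :
    ratFun ρ₀ t w * (x : ℂ) ^ w = phi t x w / (w - pole ρ₀ t) := by
  unfold ratFun phi pole
  have : w - 1 / 2 + t * I - ρ₀ = w - (ρ₀ + 1 / 2 - t * I) := by ring
  rw [this, div_mul_eq_mul_div, div_div]
  congr 1
  ring

/-- `φ` is holomorphic on `Re w > −1` (`x > 0`). [cite: BettinGonek2017, §2] -/
theorem differentiableOn_phi (t : ℝ) {x : ℝ} (hx : 0 < x) :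
    DifferentiableOn ℂ (phi t x) {w : ℂ | -1 < w.re} := by
  intro w hw
  apply DifferentiableAt.differentiableWithinAt
  unfold phi
  refine DifferentiableAt.div ?_ (by fun_prop) (kernel_den_ne_zero hw)
  exact (by fun_prop : DifferentiableAt ℂ (fun w ↦ w - 3 / 2 + t * I) w).mul
    (differentiableAt_id.const_cpow (Or.inl (by exact_mod_cast hx.ne')))

/-- `1 ≤ ‖w − w₁‖` on `Re w = 0`, on `Re w = 3`, and when `|Im w − Im w₁| ≥ 1`.
[cite: BettinGonek2017, §2] -/
theorem one_le_norm_sub_pole {ρ₀ : ℂ} (hζ : riemannZeta ρ₀ = 0) (hβ : 1 / 2 ≤ ρ₀.re) (t : ℝ)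
    {w : ℂ} (h : w.re = 0 ∨ w.re = 3 ∨ 1 ≤ |w.im - (pole ρ₀ t).im|) :
    1 ≤ ‖w - pole ρ₀ t‖ := by
  have hβ1 := Literature.NumberTheory.LFunctions.re_lt_one_of_riemannZeta_eq_zero hζ
  have hre : (w - pole ρ₀ t).re = w.re - (ρ₀.re + 1 / 2) := by simp [pole]
  rcases h with h | h | h
  · have := abs_re_le_norm (w - pole ρ₀ t)
    rw [hre, h, abs_of_neg (by linarith)] at this
    linarith
  · have := abs_re_le_norm (w - pole ρ₀ t)
    rw [hre, h, abs_of_pos (by linarith)] at this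
    linarith
  · have := abs_im_le_norm (w - pole ρ₀ t)
    rw [sub_im] at this
    linarith

/-- **Decay of the rational function**: for `0 ≤ Re w ≤ 3` and `‖w − w₁‖ ≥ 1`,
`‖ratFun(w)‖ ≤ 2/(1 + (Im w)²)`. [cite: BettinGonek2017, §2] -/
theorem norm_ratFun_le {ρ₀ : ℂ} {t : ℝ} {w : ℂ} (h0 : 0 ≤ w.re) (h3 : w.re ≤ 3)
    (hd : 1 ≤ ‖w - pole ρ₀ t‖) : ‖ratFun ρ₀ t w‖ ≤ 2 / (1 + w.im ^ 2) := by
  set u : ℝ := w.im + t with hu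
  have hnum : ‖w - 3 / 2 + t * I‖ ≤ 3 / 2 + |u| := by
    have e : w - 3 / 2 + t * I = ((w.re - 3 / 2 : ℝ) : ℂ) + (u : ℂ) * I := by
      apply Complex.ext <;> simp [hu]
    rw [e]
    calc ‖((w.re - 3 / 2 : ℝ) : ℂ) + (u : ℂ) * I‖ ≤ ‖((w.re - 3 / 2 : ℝ) : ℂ)‖ + ‖(u : ℂ) * I‖ :=
          norm_add_le _ _
      _ = |w.re - 3 / 2| + |u| := by
          rw [Complex.norm_real, Real.norm_eq_abs]; simp
      _ ≤ 3 / 2 + |u| := by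
          gcongr; rw [abs_le]; constructor <;> linarith
  have hA : 1 + w.im ^ 2 ≤ ‖(w + 1) ^ 2‖ := by
    rw [norm_pow, Complex.sq_norm, Complex.normSq_apply]
    simp only [add_re, one_re, add_im, one_im, add_zero]
    nlinarith
  have hB : 1 + u ^ 2 ≤ ‖(w + 1 + t * I) ^ 6‖ := by
    have h1 : 1 + u ^ 2 ≤ ‖w + 1 + t * I‖ ^ 2 := by
      rw [Complex.sq_norm, Complex.normSq_apply]
      simp only [add_re, one_re, mul_re, ofReal_re, I_re, mul_zero, ofReal_im, I_im, mul_one,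
        sub_self, add_zero, add_im, one_im, mul_im, hu]
      nlinarith
    have h2 : 1 ≤ ‖w + 1 + t * I‖ ^ 2 := le_trans (by nlinarith) h1
    rw [norm_pow]
    calc 1 + u ^ 2 ≤ ‖w + 1 + t * I‖ ^ 2 := h1
      _ = ‖w + 1 + t * I‖ ^ 2 * 1 * 1 := by ring
      _ ≤ ‖w + 1 + t * I‖ ^ 2 * ‖w + 1 + t * I‖ ^ 2 * ‖w + 1 + t * I‖ ^ 2 := by gcongr
      _ = ‖w + 1 + t * I‖ ^ 6 := by ring
  have hw1 : w - 1 / 2 + t * I - ρ₀ = w - pole ρ₀ t := by simp [pole]; ring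
  unfold ratFun
  rw [hw1, norm_div, norm_mul, norm_mul]
  have hpos1 : 0 < 1 + w.im ^ 2 := by positivity
  have hpos2 : 0 < 1 + u ^ 2 := by positivity
  have hkey : (3 / 2 + |u|) ≤ 2 * (1 + u ^ 2) := by
    nlinarith [abs_nonneg u, sq_abs u, sq_nonneg (|u| - 1)]
  calc ‖w - 3 / 2 + t * I‖ / (‖(w + 1) ^ 2‖ * ‖w - pole ρ₀ t‖ * ‖(w + 1 + t * I) ^ 6‖)
      ≤ (3 / 2 + |u|) / ((1 + w.im ^ 2) * 1 * (1 + u ^ 2)) := by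
        gcongr
    _ ≤ 2 * (1 + u ^ 2) / ((1 + w.im ^ 2) * 1 * (1 + u ^ 2)) := by gcongr
    _ = 2 / (1 + w.im ^ 2) := by field_simp

/-! ## Moving the line for `ratFun(w) x^w` past the pole -/

/-- The function whose line integrals are shifted: `dslope φ w₁ (w) + φ(w₁)/(w − w₁ + 3)`, holomorphic
on `Re w > −1`; off `w₁` it equals `ratFun(w) x^w − φ(w₁)(1/(w−w₁) − 1/(w−(w₁−3)))`.
[cite: BettinGonek2017, §2] -/
def shiftFun (ρ₀ : ℂ) (t x : ℝ) (w : ℂ) : ℂ :=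
  dslope (phi t x) (pole ρ₀ t) w + phi t x (pole ρ₀ t) / (w - (pole ρ₀ t - 3))

/-- Off the pole, `shiftFun = ratFun · x^w −` (explicit pair of simple fractions).
[cite: BettinGonek2017, §2] -/
theorem shiftFun_eq {ρ₀ : ℂ} {t x : ℝ} {w : ℂ} (hw : w ≠ pole ρ₀ t) :
    shiftFun ρ₀ t x w = ratFun ρ₀ t w * (x : ℂ) ^ w -
      phi t x (pole ρ₀ t) * (1 / (w - pole ρ₀ t) - 1 / (w - (pole ρ₀ t - 3))) := by
  rw [shiftFun, dslope_of_ne _ hw, slope_def_field, ratFun_mul_cpow]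
  have h1 : w - pole ρ₀ t ≠ 0 := sub_ne_zero.2 hw
  field_simp
  ring

/-- `shiftFun` is holomorphic on `Re w > −1` (`x > 0`). [cite: BettinGonek2017, §2] -/
theorem differentiableOn_shiftFun {ρ₀ : ℂ} (hζ : riemannZeta ρ₀ = 0) (hβ : 1 / 2 ≤ ρ₀.re)
    (t : ℝ) {x : ℝ} (hx : 0 < x) :
    DifferentiableOn ℂ (shiftFun ρ₀ t x) {w : ℂ | -1 < w.re} := by
  have hβ1 := Literature.NumberTheory.LFunctions.re_lt_one_of_riemannZeta_eq_zero hζ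
  have hopen : IsOpen {w : ℂ | -1 < w.re} := isOpen_lt continuous_const Complex.continuous_re
  have hmem : {w : ℂ | -1 < w.re} ∈ nhds (pole ρ₀ t) := by
    refine hopen.mem_nhds ?_
    simp only [mem_setOf_eq, pole, sub_re, add_re, ofReal_re, mul_re, I_re, mul_zero, ofReal_im,
      I_im, mul_one, sub_self, sub_zero]
    norm_num; linarith
  refine DifferentiableOn.add ((differentiableOn_dslope hmem).2 (differentiableOn_phi t hx)) ?_
  intro w hw
  refine (DifferentiableAt.div (differentiableAt_const _) (by fun_prop) ?_).differentiableWithinAt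
  intro h
  have := congrArg Complex.re h
  simp [pole] at this
  simp only [mem_setOf_eq] at hw
  linarith

/-- Integrability of `v ↦ ratFun(c+iv) x^{c+iv}` on the lines `c = 0` and `c = 3`.
[cite: BettinGonek2017, §2] -/
theorem integrable_ratFun_line {ρ₀ : ℂ} (hζ : riemannZeta ρ₀ = 0) (hβ : 1 / 2 ≤ ρ₀.re) (t : ℝ)
    {x : ℝ} (hx : 0 < x) {c : ℝ} (hc : c = 0 ∨ c = 3) :
    Integrable fun v : ℝ ↦ ratFun ρ₀ t (c + v * I) * (x : ℂ) ^ ((c : ℂ) + v * I) := by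
  have hc0 : 0 ≤ c := by rcases hc with h | h <;> simp [h]
  have hc3 : c ≤ 3 := by rcases hc with h | h <;> simp [h]
  have hcw : ∀ v : ℝ, ((c : ℂ) + v * I).re = 0 ∨ ((c : ℂ) + v * I).re = 3 ∨
      1 ≤ |((c : ℂ) + v * I).im - (pole ρ₀ t).im| := by
    intro v; rcases hc with h | h <;> simp [h]
  have hcont : Continuous fun v : ℝ ↦ ratFun ρ₀ t (c + v * I) * (x : ℂ) ^ ((c : ℂ) + v * I) := by
    refine Continuous.mul ?_ (continuous_cpow_line hx c)
    unfold ratFun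
    refine Continuous.div (by fun_prop) (by fun_prop) fun v ↦ ?_
    have h1 := kernel_den_ne_zero (t := t) (w := c + v * I) (by simp; linarith)
    have h2 : (c : ℂ) + v * I - 1 / 2 + t * I - ρ₀ ≠ 0 := by
      have : (c : ℂ) + v * I - 1 / 2 + t * I - ρ₀ = (c + v * I) - pole ρ₀ t := by
        simp [pole]; ring
      rw [this, ← norm_pos_iff]
      exact lt_of_lt_of_le one_pos (one_le_norm_sub_pole hζ hβ t (hcw v))
    rw [mul_ne_zero_iff] at h1
    exact mul_ne_zero (mul_ne_zero h1.1 h2) h1.2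
  refine Literature.Analysis.Complex.VLI.integrable_of_continuous_of_norm_le hcont (R := 0)
    (C := 2 * x ^ c) fun v _ ↦ ?_
  rw [norm_mul, Literature.NumberTheory.LFunctions.norm_cpow_line hx]
  have := norm_ratFun_le (ρ₀ := ρ₀) (t := t) (w := c + v * I) (by simp [hc0]) (by simp [hc3])
    (one_le_norm_sub_pole hζ hβ t (hcw v))
  simp only [add_im, ofReal_im, mul_im, ofReal_re, I_im, mul_one, I_re, mul_zero, add_zero,
    zero_add] at this
  calc ‖ratFun ρ₀ t (c + v * I)‖ * x ^ c ≤ 2 / (1 + v ^ 2) * x ^ c := by gcongr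
    _ = 2 * x ^ c * (1 + v ^ 2)⁻¹ := by ring

/-- **The line integrals of `shiftFun`** on `c ∈ {0, 3}`:
`∫ shiftFun(c+iv) dv = ∫ ratFun(c+iv) x^{c+iv} dv − φ(w₁) · 2π(𝟙[Re w₁ < c] − 𝟙[Re w₁ − 3 < c])`.
[cite: BettinGonek2017, §2] -/
theorem integral_shiftFun_line {ρ₀ : ℂ} (hζ : riemannZeta ρ₀ = 0) (hβ : 1 / 2 ≤ ρ₀.re) (t : ℝ)
    {x : ℝ} (hx : 0 < x) {c : ℝ} (hc : c = 0 ∨ c = 3) :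
    (Integrable fun v : ℝ ↦ shiftFun ρ₀ t x (c + v * I)) ∧
    ∫ v : ℝ, shiftFun ρ₀ t x (c + v * I) =
      (∫ v : ℝ, ratFun ρ₀ t (c + v * I) * (x : ℂ) ^ ((c : ℂ) + v * I)) -
        phi t x (pole ρ₀ t) * (2 * π * ((if (pole ρ₀ t).re < c then 1 else 0) -
          (if (pole ρ₀ t - 3).re < c then 1 else 0))) := by
  have hβ1 := Literature.NumberTheory.LFunctions.re_lt_one_of_riemannZeta_eq_zero hζ
  have hpre : (pole ρ₀ t).re = ρ₀.re + 1 / 2 := by simp [pole]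
  have ha : (pole ρ₀ t).re ≠ c := by rw [hpre]; rcases hc with h | h <;> rw [h] <;> linarith
  have hb : (pole ρ₀ t - 3).re ≠ c := by
    rw [sub_re, hpre]; rcases hc with h | h <;> rw [h] <;> norm_num <;> linarith
  have hne : ∀ v : ℝ, (c : ℂ) + v * I ≠ pole ρ₀ t := by
    intro v h
    have := congrArg Complex.re h
    simp at this
    exact ha (by rw [this])
  have heq : (fun v : ℝ ↦ shiftFun ρ₀ t x (c + v * I)) = fun v : ℝ ↦
      ratFun ρ₀ t (c + v * I) * (x : ℂ) ^ ((c : ℂ) + v * I) -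
        phi t x (pole ρ₀ t) * (1 / ((c : ℂ) + v * I - pole ρ₀ t) -
          1 / ((c : ℂ) + v * I - (pole ρ₀ t - 3))) := by
    funext v; exact shiftFun_eq (hne v)
  have hI1 := integrable_ratFun_line hζ hβ t hx hc
  have hI2 := (Literature.Analysis.Complex.VLI.integrable_inv_sub_inv ha hb).const_mul
    (phi t x (pole ρ₀ t))
  rw [heq]
  refine ⟨hI1.sub hI2, ?_⟩
  rw [integral_sub hI1 hI2, integral_const_mul,
    Literature.Analysis.Complex.VLI.integral_inv_sub_inv ha hb]

/-- `x^σ ≤ max 1 x³` for `0 ≤ σ ≤ 3`, `x > 0`. [folklore] -/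
theorem rpow_le_max {x : ℝ} (hx : 0 < x) {σ : ℝ} (h0 : 0 ≤ σ) (h3 : σ ≤ 3) :
    x ^ σ ≤ max 1 (x ^ (3 : ℝ)) := by
  rcases le_or_gt 1 x with hx1 | hx1
  · exact (Real.rpow_le_rpow_of_exponent_le hx1 h3).trans (le_max_right _ _)
  · exact (Real.rpow_le_one hx.le hx1.le h0).trans (le_max_left _ _)

/-- **The residue identity**: `J_t(x) = ∫ ratFun(iv) x^{iv} dv + 2π φ(w₁)` (move `Re w = 3` to
`Re w = 0` past the simple pole `w₁`, `Re w₁ = Re ρ₀ + ½ ∈ [1, 3/2)`). [cite: BettinGonek2017, §2] -/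
theorem J_eq_residue {ρ₀ : ℂ} (hζ : riemannZeta ρ₀ = 0) (hβ : 1 / 2 ≤ ρ₀.re) (t : ℝ) {x : ℝ}
    (hx : 0 < x) :
    J ρ₀ t x = (∫ v : ℝ, ratFun ρ₀ t (v * I) * (x : ℂ) ^ ((v : ℂ) * I)) +
      2 * π * phi t x (pole ρ₀ t) := by
  have hβ1 := Literature.NumberTheory.LFunctions.re_lt_one_of_riemannZeta_eq_zero hζ
  have hpre : (pole ρ₀ t).re = ρ₀.re + 1 / 2 := by simp [pole]
  obtain ⟨hI0, h0⟩ := integral_shiftFun_line hζ hβ t hx (c := 0) (Or.inl rfl)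
  obtain ⟨hI3, h3⟩ := integral_shiftFun_line hζ hβ t hx (c := 3) (Or.inr rfl)
  have i1 : (if (pole ρ₀ t).re < (0 : ℝ) then (1 : ℂ) else 0) = 0 := if_neg (by rw [hpre]; linarith)
  have i2 : (if (pole ρ₀ t - 3).re < (0 : ℝ) then (1 : ℂ) else 0) = 1 :=
    if_pos (by rw [sub_re, hpre]; norm_num; linarith)
  have i3 : (if (pole ρ₀ t).re < (3 : ℝ) then (1 : ℂ) else 0) = 1 := if_pos (by rw [hpre]; linarith)
  have i4 : (if (pole ρ₀ t - 3).re < (3 : ℝ) then (1 : ℂ) else 0) = 1 :=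
    if_pos (by rw [sub_re, hpre]; norm_num; linarith)
  rw [i1, i2] at h0
  rw [i3, i4] at h3
  -- the shift
  have hshift := Literature.NumberTheory.LFunctions.MertensBoundRH.integral_vertical_eq_of_tendsto
    (shiftFun ρ₀ t x) (by norm_num : (0 : ℝ) ≤ 3)
    ((differentiableOn_shiftFun hζ hβ t hx).mono fun w hw ↦ by
      have := (mem_reProdIm.1 hw).1.1; simp only [mem_setOf_eq]; linarith) hI0 hI3 ?_
  · rw [h0, h3] at hshift
    have hI0' : (∫ v : ℝ, ratFun ρ₀ t (((0 : ℝ) : ℂ) + v * I) * (x : ℂ) ^ (((0 : ℝ) : ℂ) + v * I)) =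
        ∫ v : ℝ, ratFun ρ₀ t (v * I) * (x : ℂ) ^ ((v : ℂ) * I) := by
      simp only [Complex.ofReal_zero, zero_add]
    have hI3' : (∫ v : ℝ, ratFun ρ₀ t (((3 : ℝ) : ℂ) + v * I) * (x : ℂ) ^ (((3 : ℝ) : ℂ) + v * I)) =
        J ρ₀ t x := by
      unfold J; simp only [Complex.ofReal_ofNat]
    rw [hI0', hI3'] at hshift
    linear_combination -hshift
  -- uniform decay in the strip
  intro ε hε
  set M : ℝ := max 1 (x ^ (3 : ℝ)) with hM
  have hM1 : 1 ≤ M := le_max_left _ _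
  set φ₁ : ℂ := phi t x (pole ρ₀ t) with hφ₁
  set p : ℂ := pole ρ₀ t with hp
  refine ⟨|p.im| + 1 + 4 * M / ε + 4 * ‖φ₁‖ / ε, fun σ hσ T hT ↦ ?_⟩
  have hpos1 : 0 ≤ 4 * M / ε := by positivity
  have hpos2 : 0 ≤ 4 * ‖φ₁‖ / ε := by positivity
  have hT1 : 1 ≤ |T| - |p.im| := by linarith [abs_nonneg p.im]
  have hTim : 1 ≤ |((σ : ℂ) + T * I).im - p.im| := by
    have : ((σ : ℂ) + T * I).im = T := by simp
    rw [this]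
    have := abs_sub_abs_le_abs_sub T p.im
    linarith
  have hne : (σ : ℂ) + T * I ≠ p := by
    intro h; rw [h, sub_self, abs_zero] at hTim; linarith
  rw [shiftFun_eq hne]
  have hσ0 : 0 ≤ σ := hσ.1
  have hσ3 : σ ≤ 3 := hσ.2
  -- first term
  have hA : ‖ratFun ρ₀ t (σ + T * I) * (x : ℂ) ^ ((σ : ℂ) + T * I)‖ ≤ 2 * M / |T| := by
    rw [norm_mul, Literature.NumberTheory.LFunctions.norm_cpow_line hx]
    have h1 := norm_ratFun_le (ρ₀ := ρ₀) (t := t) (w := σ + T * I) (by simp [hσ0]) (by simp [hσ3])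
      (one_le_norm_sub_pole hζ hβ t (Or.inr (Or.inr hTim)))
    simp only [add_im, ofReal_im, mul_im, ofReal_re, I_im, mul_one, I_re, mul_zero, add_zero,
      zero_add] at h1
    have hT0 : 0 < |T| := by linarith [abs_nonneg p.im]
    calc ‖ratFun ρ₀ t (σ + T * I)‖ * x ^ σ ≤ 2 / (1 + T ^ 2) * M := by
          gcongr; exact rpow_le_max hx hσ0 hσ3
      _ ≤ 2 / |T| * M := by
          gcongr
          rw [← sq_abs]; nlinarith
      _ = 2 * M / |T| := by ring
  -- second term
  have hB : ‖φ₁ * (1 / ((σ : ℂ) + T * I - p) - 1 / ((σ : ℂ) + T * I - (p - 3)))‖ ≤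
      ‖φ₁‖ * (2 / (|T| - |p.im|)) := by
    rw [norm_mul]
    gcongr
    have hq : ∀ q : ℂ, q.im = p.im → 1 ≤ |T| - |p.im| → ‖1 / ((σ : ℂ) + T * I - q)‖ ≤ 1 / (|T| - |p.im|) := by
      intro q hq h1
      rw [norm_div, norm_one]
      apply div_le_div_of_nonneg_left zero_le_one (by linarith)
      have := abs_im_le_norm ((σ : ℂ) + T * I - q)
      simp only [sub_im, add_im, ofReal_im, mul_im, ofReal_re, I_im, mul_one, I_re, mul_zero,
        add_zero, zero_add, hq] at this
      linarith [abs_sub_abs_le_abs_sub T p.im]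
    calc ‖1 / ((σ : ℂ) + T * I - p) - 1 / ((σ : ℂ) + T * I - (p - 3))‖
        ≤ ‖1 / ((σ : ℂ) + T * I - p)‖ + ‖1 / ((σ : ℂ) + T * I - (p - 3))‖ := norm_sub_le _ _
      _ ≤ 1 / (|T| - |p.im|) + 1 / (|T| - |p.im|) :=
          add_le_add (hq p rfl hT1) (hq (p - 3) (by simp) hT1)
      _ = 2 / (|T| - |p.im|) := by ring
  -- combine
  have hT2 : 4 * M / ε ≤ |T| := by linarith [abs_nonneg p.im]
  have hT3 : 4 * ‖φ₁‖ / ε + 1 ≤ |T| - |p.im| := by linarith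
  have hA' : 2 * M / |T| ≤ ε / 2 := by
    have hT0 : 0 < |T| := by linarith [abs_nonneg p.im]
    rw [div_le_iff₀ hT0]
    calc 2 * M = ε / 2 * (4 * M / ε) := by field_simp; ring
      _ ≤ ε / 2 * |T| := by gcongr
  have hB' : ‖φ₁‖ * (2 / (|T| - |p.im|)) ≤ ε / 2 := by
    have hden : 0 < |T| - |p.im| := by linarith
    rw [mul_div_assoc', div_le_iff₀ hden]
    calc ‖φ₁‖ * 2 = ε / 2 * (4 * ‖φ₁‖ / ε) := by field_simp; ring
      _ ≤ ε / 2 * (|T| - |p.im|) := by gcongr; linarith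
  calc ‖ratFun ρ₀ t (σ + T * I) * (x : ℂ) ^ ((σ : ℂ) + T * I) -
        φ₁ * (1 / ((σ : ℂ) + T * I - p) - 1 / ((σ : ℂ) + T * I - (p - 3)))‖
      ≤ ‖ratFun ρ₀ t (σ + T * I) * (x : ℂ) ^ ((σ : ℂ) + T * I)‖ +
        ‖φ₁ * (1 / ((σ : ℂ) + T * I - p) - 1 / ((σ : ℂ) + T * I - (p - 3)))‖ := norm_sub_le _ _
    _ ≤ ε / 2 + ε / 2 := add_le_add (hA.trans hA') (hB.trans hB')
    _ = ε := by ring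

/-- The shifted line integral is `O(1)`: `‖∫ ratFun(iv) x^{iv} dv‖ ≤ 2π`, uniformly in `t` and
`x > 0`. [cite: BettinGonek2017, §2] -/
theorem norm_integral_ratFun_zero_le {ρ₀ : ℂ} (hζ : riemannZeta ρ₀ = 0) (hβ : 1 / 2 ≤ ρ₀.re)
    (t : ℝ) {x : ℝ} (hx : 0 < x) :
    ‖∫ v : ℝ, ratFun ρ₀ t (v * I) * (x : ℂ) ^ ((v : ℂ) * I)‖ ≤ 2 * π := by
  have hint : Integrable fun v : ℝ ↦ 2 * (1 + v ^ 2)⁻¹ := integrable_inv_one_add_sq.const_mul 2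
  have hval : ∫ v : ℝ, 2 * (1 + v ^ 2)⁻¹ = 2 * π := by
    rw [integral_const_mul, integral_univ_inv_one_add_sq]
  rw [← hval]
  refine norm_integral_le_of_norm_le hint (Eventually.of_forall fun v ↦ ?_)
  have h0 := Literature.NumberTheory.LFunctions.norm_cpow_line hx 0 v
  simp only [Complex.ofReal_zero, zero_add, Real.rpow_zero] at h0
  rw [norm_mul, h0, mul_one]
  have := norm_ratFun_le (ρ₀ := ρ₀) (t := t) (w := v * I) (by simp) (by simp)
    (one_le_norm_sub_pole hζ hβ t (Or.inl (by simp)))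
  simpa [div_eq_mul_inv] using this

/-- The constant `c₁(ρ₀) = ‖ρ₀ − 1‖/‖ρ₀ + 3/2‖⁸ > 0` of the residue lower bound.
[cite: BettinGonek2017, §2] -/
def residueConst (ρ₀ : ℂ) : ℝ := ‖ρ₀ - 1‖ / ‖ρ₀ + 3 / 2‖ ^ 8

/-- `c₁(ρ₀) > 0` for a zero `ρ₀` of `ζ`. [cite: BettinGonek2017, §2] -/
theorem residueConst_pos {ρ₀ : ℂ} (hζ : riemannZeta ρ₀ = 0) (hβ : 1 / 2 ≤ ρ₀.re) :
    0 < residueConst ρ₀ := by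
  unfold residueConst
  have h1 : 0 < ‖ρ₀ - 1‖ := norm_pos_iff.2 (sub_ne_zero.2 (Literature.NumberTheory.LFunctions.ne_one_of_riemannZeta_eq_zero hζ))
  have h2 : 0 < ‖ρ₀ + 3 / 2‖ := by
    have := abs_re_le_norm (ρ₀ + 3 / 2)
    have h : (ρ₀ + 3 / 2).re = ρ₀.re + 3 / 2 := by simp
    rw [h, abs_of_pos (by linarith)] at this
    linarith
  positivity

/-- **Size of the residue**: `‖φ(w₁)‖ ≥ c₁(ρ₀) x^{Re ρ₀ + ½}/(1+|t|)²` (`x > 0`), since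
`φ(w₁) = (ρ₀ − 1) x^{ρ₀+½−it}/((ρ₀+3/2−it)²(ρ₀+3/2)⁶)` and `‖ρ₀ + 3/2 − it‖ ≤ ‖ρ₀+3/2‖(1+|t|)`.
[cite: BettinGonek2017, §2] -/
theorem residueConst_mul_le_norm_phi {ρ₀ : ℂ} (hβ : 1 / 2 ≤ ρ₀.re) (t : ℝ) {x : ℝ}
    (hx : 0 < x) :
    residueConst ρ₀ * x ^ (ρ₀.re + 1 / 2) / (1 + |t|) ^ 2 ≤ ‖phi t x (pole ρ₀ t)‖ := by
  have hR : 2 ≤ ‖ρ₀ + 3 / 2‖ := by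
    have := abs_re_le_norm (ρ₀ + 3 / 2)
    have h : (ρ₀ + 3 / 2).re = ρ₀.re + 3 / 2 := by simp
    rw [h, abs_of_pos (by linarith)] at this
    linarith
  have hR0 : 0 < ‖ρ₀ + 3 / 2‖ := by linarith
  have e1 : pole ρ₀ t - 3 / 2 + t * I = ρ₀ - 1 := by simp [pole]; ring
  have e2 : pole ρ₀ t + 1 = ρ₀ + 3 / 2 - t * I := by simp [pole]; ring
  have e3 : ρ₀ + 3 / 2 - t * I + t * I = ρ₀ + 3 / 2 := by ring
  have hxp : ‖(x : ℂ) ^ pole ρ₀ t‖ = x ^ (ρ₀.re + 1 / 2) := by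
    rw [Complex.norm_cpow_eq_rpow_re_of_pos hx]; simp [pole]
  have hden1 : ‖ρ₀ + 3 / 2 - t * I‖ ≤ ‖ρ₀ + 3 / 2‖ * (1 + |t|) := by
    calc ‖ρ₀ + 3 / 2 - t * I‖ ≤ ‖ρ₀ + 3 / 2‖ + ‖(t : ℂ) * I‖ := norm_sub_le _ _
      _ = ‖ρ₀ + 3 / 2‖ + |t| := by simp
      _ ≤ ‖ρ₀ + 3 / 2‖ + ‖ρ₀ + 3 / 2‖ * |t| := by
          gcongr; exact le_mul_of_one_le_left (abs_nonneg t) (by linarith)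
      _ = ‖ρ₀ + 3 / 2‖ * (1 + |t|) := by ring
  have hden1' : 0 < ‖ρ₀ + 3 / 2 - t * I‖ := by
    have := abs_re_le_norm (ρ₀ + 3 / 2 - t * I)
    have h : (ρ₀ + 3 / 2 - t * I).re = ρ₀.re + 3 / 2 := by simp
    rw [h, abs_of_pos (by linarith)] at this
    linarith
  unfold phi residueConst
  rw [e1, e2, e3, norm_div, norm_mul, norm_mul, norm_pow, norm_pow, hxp]
  have hpos : 0 < ‖ρ₀ + 3 / 2 - t * I‖ ^ 2 * ‖ρ₀ + 3 / 2‖ ^ 6 := by positivity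
  rw [div_mul_eq_mul_div, div_div, le_div_iff₀ hpos, div_mul_eq_mul_div, div_le_iff₀ (by positivity)]
  calc ‖ρ₀ - 1‖ * x ^ (ρ₀.re + 1 / 2) * (‖ρ₀ + 3 / 2 - t * I‖ ^ 2 * ‖ρ₀ + 3 / 2‖ ^ 6)
      ≤ ‖ρ₀ - 1‖ * x ^ (ρ₀.re + 1 / 2) * ((‖ρ₀ + 3 / 2‖ * (1 + |t|)) ^ 2 * ‖ρ₀ + 3 / 2‖ ^ 6) := by
        gcongr
    _ = ‖ρ₀ - 1‖ * x ^ (ρ₀.re + 1 / 2) * (‖ρ₀ + 3 / 2‖ ^ 8 * (1 + |t|) ^ 2) := by ring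

/-- **The first-moment inequality** (Bettin–Gonek, display before Cauchy–Schwarz, our constants):
`c₁(ρ₀) x^{β₀+½}/(1+|t|)² ≤ (625/2) ∫_1^x |M_y(½+it)| log y dy + 1` for `x ≥ 1`.
[cite: BettinGonek2017, §2] -/
theorem firstMoment_ineq {ρ₀ : ℂ} (hζ : riemannZeta ρ₀ = 0) (hβ : 1 / 2 ≤ ρ₀.re) (t : ℝ)
    {x : ℝ} (hx : 1 ≤ x) :
    residueConst ρ₀ * x ^ (ρ₀.re + 1 / 2) / (1 + |t|) ^ 2 ≤
      625 / 2 * (∫ y in (1 : ℝ)..x, ‖levinsonMollifierLog y (1 / 2 + t * I)‖) + 1 := by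
  have hx0 : 0 < x := by linarith
  have h1 := residueConst_mul_le_norm_phi hβ t hx0
  have h2 := norm_J_le hζ hβ t hx
  have h3 := norm_integral_ratFun_zero_le hζ hβ t hx0
  have h4 := J_eq_residue hζ hβ t hx0
  set φ₁ := phi t x (pole ρ₀ t)
  set I₀ := ∫ v : ℝ, ratFun ρ₀ t (v * I) * (x : ℂ) ^ ((v : ℂ) * I)
  set P := ∫ y in (1 : ℝ)..x, ‖levinsonMollifierLog y (1 / 2 + t * I)‖
  have h5 : ‖(2 * π : ℂ) * φ₁‖ ≤ ‖J ρ₀ t x‖ + ‖I₀‖ := by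
    have : (2 * π : ℂ) * φ₁ = J ρ₀ t x - I₀ := by rw [h4]; ring
    rw [this]; exact norm_sub_le _ _
  have h6 : ‖(2 * π : ℂ) * φ₁‖ = 2 * π * ‖φ₁‖ := by
    rw [norm_mul]; simp [abs_of_pos Real.pi_pos]
  have h7 : 2 * π * ‖φ₁‖ ≤ 625 * π * P + 2 * π := by linarith
  have h8 : ‖φ₁‖ ≤ 625 / 2 * P + 1 := by
    have hπ := Real.pi_pos
    nlinarith
  exact h1.trans h8

/-! ## From the first moment to the printed second-moment lower bound -/

/-- `y ↦ ‖M_y(s) log y‖` is interval integrable (`Re s ≥ 0`). [cite: BettinGonek2017, §2] -/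
theorem intervalIntegrable_norm_levinsonMollifierLog {s : ℂ} (hs : 0 ≤ s.re) (a b : ℝ) :
    IntervalIntegrable (fun y : ℝ ↦ ‖levinsonMollifierLog y s‖) volume a b := by
  rw [intervalIntegrable_iff]
  refine Measure.integrableOn_of_bounded (M := (max |a| |b|) ^ 2) measure_Ioc_lt_top.ne
    ((measurable_levinsonMollifierLog s).norm).aestronglyMeasurable ?_
  refine (ae_restrict_iff' measurableSet_uIoc).2 (Filter.Eventually.of_forall fun y hy ↦ ?_)
  have hyM : |y| ≤ max |a| |b| := by
    rcases Set.mem_uIoc.1 hy with ⟨h1, h2⟩ | ⟨h1, h2⟩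
    · exact abs_le_max_abs_abs h1.le h2
    · rw [max_comm]; exact abs_le_max_abs_abs h1.le h2
  rw [norm_norm]
  calc ‖levinsonMollifierLog y s‖ ≤ y ^ 2 := norm_levinsonMollifierLog_le_sq hs y
    _ = |y| ^ 2 := (sq_abs y).symm
    _ ≤ (max |a| |b|) ^ 2 := by gcongr

/-- **AM–GM in place of Cauchy–Schwarz**: for `λ > 0` and `x ≥ 1`,
`∫_1^x |M_y log y| dy ≤ λ(x−1)/2 + (1/2λ) ∫_1^x |M_y log y|² dy`. [folklore] -/
theorem integral_norm_le_amgm {s : ℂ} (hs : 0 ≤ s.re) {x : ℝ} (hx : 1 ≤ x) {lam : ℝ}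
    (hlam : 0 < lam) :
    ∫ y in (1 : ℝ)..x, ‖levinsonMollifierLog y s‖ ≤
      lam * (x - 1) / 2 + (∫ y in (1 : ℝ)..x, ‖levinsonMollifierLog y s‖ ^ 2) / (2 * lam) := by
  have hpt : ∀ y ∈ Icc (1 : ℝ) x, ‖levinsonMollifierLog y s‖ ≤
      lam / 2 + ‖levinsonMollifierLog y s‖ ^ 2 / (2 * lam) := by
    intro y _
    set u := ‖levinsonMollifierLog y s‖
    have h : 0 ≤ (u - lam) ^ 2 := sq_nonneg _
    rw [div_add_div _ _ (two_ne_zero) (by positivity), le_div_iff₀ (by positivity)]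
    nlinarith
  calc ∫ y in (1 : ℝ)..x, ‖levinsonMollifierLog y s‖
      ≤ ∫ y in (1 : ℝ)..x, (lam / 2 + ‖levinsonMollifierLog y s‖ ^ 2 / (2 * lam)) :=
        intervalIntegral.integral_mono_on hx (intervalIntegrable_norm_levinsonMollifierLog hs _ _)
          (intervalIntegrable_const.add
            ((intervalIntegrable_norm_sq_levinsonMollifierLog hs _ _).div_const _)) hpt
    _ = lam * (x - 1) / 2 + (∫ y in (1 : ℝ)..x, ‖levinsonMollifierLog y s‖ ^ 2) / (2 * lam) := by
        rw [intervalIntegral.integral_add intervalIntegrable_const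
          ((intervalIntegrable_norm_sq_levinsonMollifierLog hs _ _).div_const _),
          intervalIntegral.integral_const, intervalIntegral.integral_div, smul_eq_mul]
        ring

/-- On `[1, 2]`, `M_y(s) log y = log y` (only `n = 1` contributes; at `y = 2` the new term has
weight `log 1 = 0`). [cite: BettinGonek2017, §2] -/
theorem levinsonMollifierLog_eq_log {y : ℝ} (h1 : 1 ≤ y) (h2 : y ≤ 2) (s : ℂ) :
    levinsonMollifierLog y s = (Real.log y : ℂ) := by
  unfold levinsonMollifierLog
  rcases eq_or_lt_of_le h2 with h | h
  · subst h
    have : ⌊(2 : ℝ)⌋₊ = 2 := by norm_num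
    rw [this, Finset.sum_Icc_succ_top (by norm_num), show Finset.Icc 1 1 = {1} by rfl,
      Finset.sum_singleton]
    simp
  · have : ⌊y⌋₊ = 1 := by
      rw [Nat.floor_eq_iff (by linarith)]; exact ⟨by simpa using h1, by norm_num; linarith⟩
    rw [this, show Finset.Icc 1 1 = {1} by rfl, Finset.sum_singleton]
    simp

/-- The absolute constant `q₀ = ∫_1^2 log² y dy > 0`. [folklore] -/
theorem integral_log_sq_pos : 0 < ∫ y in (1 : ℝ)..2, Real.log y ^ 2 := by
  refine intervalIntegral.intervalIntegral_pos_of_pos_on ?_ (fun y hy ↦ ?_) one_lt_two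
  · exact ((Real.continuousOn_log.mono fun y hy ↦ by
      simp only [mem_uIcc] at hy; simp only [mem_compl_iff, mem_singleton_iff]
      rcases hy with h | h <;> linarith).pow 2).intervalIntegrable
  · exact pow_pos (Real.log_pos hy.1) 2

/-- `∫_1^x ‖M_y(s) log y‖² dy ≥ q₀` for `x ≥ 2` (`Re s ≥ 0`). [cite: BettinGonek2017, §2] -/
theorem integral_log_sq_le_integral_norm_sq {s : ℂ} (hs : 0 ≤ s.re) {x : ℝ} (hx : 2 ≤ x) :
    ∫ y in (1 : ℝ)..2, Real.log y ^ 2 ≤ ∫ y in (1 : ℝ)..x, ‖levinsonMollifierLog y s‖ ^ 2 := by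
  calc ∫ y in (1 : ℝ)..2, Real.log y ^ 2 = ∫ y in (1 : ℝ)..2, ‖levinsonMollifierLog y s‖ ^ 2 := by
        refine intervalIntegral.integral_congr fun y hy ↦ ?_
        rw [uIcc_of_le (by norm_num)] at hy
        simp only [levinsonMollifierLog_eq_log hy.1 hy.2 s, Complex.norm_real, Real.norm_eq_abs,
          sq_abs]
    _ ≤ ∫ y in (1 : ℝ)..x, ‖levinsonMollifierLog y s‖ ^ 2 :=
        intervalIntegral.integral_mono_interval le_rfl (by norm_num) hx
          (Eventually.of_forall fun _ ↦ by positivity)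
          (intervalIntegrable_norm_sq_levinsonMollifierLog hs _ _)

/-- **The second-moment lower bound from the first-moment inequality** (the "Cauchy–Schwarz"
step, done by AM–GM): if `A ≤ B P + 1` with `A, B, P ≥ 0`, `P ≤ λ x/2 + Q/(2λ)` for every
`λ > 0` (`x > 0`, `Q > 0`), then `A² ≤ max(4B², 2/q₀) · x · Q` whenever `2 q₀ ≤ x Q`. [folklore] -/
theorem sq_le_of_firstMoment {A B P Q x q₀ : ℝ} (hA : 0 ≤ A) (hB : 0 < B) (hx : 0 < x) (hQ : 0 < Q)
    (hq₀ : 0 < q₀) (hqQ : 2 * q₀ ≤ x * Q) (h1 : A ≤ B * P + 1)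
    (h2 : ∀ lam : ℝ, 0 < lam → P ≤ lam * x / 2 + Q / (2 * lam)) :
    A ^ 2 ≤ max (4 * B ^ 2) (2 / q₀) * x * Q := by
  have hK1 : 4 * B ^ 2 ≤ max (4 * B ^ 2) (2 / q₀) := le_max_left _ _
  have hK2 : 2 / q₀ ≤ max (4 * B ^ 2) (2 / q₀) := le_max_right _ _
  rcases le_or_gt 2 A with hA2 | hA2
  · have hApos : 0 < A := by linarith
    set lam : ℝ := A / (2 * B * x) with hlam
    have hlam0 : 0 < lam := by positivity
    have hP := h2 lam hlam0
    have e1 : B * (lam * x / 2) = A / 4 := by rw [hlam]; field_simp; ring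
    have e2 : B * (Q / (2 * lam)) = B ^ 2 * x * Q / A := by rw [hlam]; field_simp
    have h3 : A / 2 ≤ A / 4 + B ^ 2 * x * Q / A := by
      calc A / 2 ≤ A - 1 := by linarith
        _ ≤ B * P := by linarith
        _ ≤ B * (lam * x / 2 + Q / (2 * lam)) := by gcongr
        _ = A / 4 + B ^ 2 * x * Q / A := by rw [mul_add, e1, e2]
    have h4 : A / 4 ≤ B ^ 2 * x * Q / A := by linarith
    rw [le_div_iff₀ hApos] at h4
    calc A ^ 2 = 4 * (A / 4 * A) := by ring
      _ ≤ 4 * (B ^ 2 * x * Q) := by gcongr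
      _ = 4 * B ^ 2 * (x * Q) := by ring
      _ ≤ max (4 * B ^ 2) (2 / q₀) * (x * Q) := by gcongr
      _ = max (4 * B ^ 2) (2 / q₀) * x * Q := by ring
  · calc A ^ 2 ≤ 2 ^ 2 := by gcongr
      _ = 2 / q₀ * (2 * q₀) := by field_simp
      _ ≤ 2 / q₀ * (x * Q) := by gcongr
      _ ≤ max (4 * B ^ 2) (2 / q₀) * (x * Q) := by gcongr
      _ = max (4 * B ^ 2) (2 / q₀) * x * Q := by ring

end BettinGonek2017

open BettinGonek2017 in
/-- **Discharge of `BettinGonek2017_lowerBound`** (Bettin–Gonek 2017, §2, the display after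
Cauchy–Schwarz): for every zero `ρ₀` of `ζ` with `Re ρ₀ ≥ ½` there is `c = c(ρ₀) > 0` with
`c (x^{2β₀}/(1+|t|)⁴ + 1/x) ≤ ∫_1^x |M_y(½+it) log y|² dy` for all `x ≥ 2` and real `t`.
Proof as printed (with the kernel exponent `6` and AM–GM for Cauchy–Schwarz): `H_t` by termwise
integration (`integral_levinsonMollifierLog_mul_cpow`), `J_t(x)` by Mellin convolution
(`norm_J_le`) and by the residue at `w₁ = ρ₀ + ½ − it` (`J_eq_residue`), giving
`c₁ x^{β₀+½}/(1+|t|)² ≤ (625/2)∫_1^x |M_y log y| dy + 1` (`firstMoment_ineq`).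
[cite: BettinGonek2017, §2] -/
theorem BettinGonek2017_lowerBound_holds : BettinGonek2017_lowerBound := by
  intro ρ₀ hζ hβ
  set c₁ : ℝ := residueConst ρ₀ with hc₁def
  have hc₁ : 0 < c₁ := residueConst_pos hζ hβ
  set B : ℝ := 625 / 2 with hB
  set q₀ : ℝ := ∫ y in (1 : ℝ)..2, Real.log y ^ 2 with hq₀def
  have hq₀ : 0 < q₀ := integral_log_sq_pos
  set K : ℝ := max (4 * B ^ 2) (2 / q₀) with hK
  have hK0 : 0 < K := lt_max_of_lt_left (by positivity)
  refine ⟨1 / (K / c₁ ^ 2 + 1 / (2 * q₀)), by positivity, fun x hx t ↦ ?_⟩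
  have hx0 : 0 < x := by linarith
  set s : ℂ := 1 / 2 + t * I with hs_def
  have hs : 0 ≤ s.re := by simp [hs_def]
  set P : ℝ := ∫ y in (1 : ℝ)..x, ‖levinsonMollifierLog y s‖ with hP
  set Q : ℝ := ∫ y in (1 : ℝ)..x, ‖levinsonMollifierLog y s‖ ^ 2 with hQ
  have hqQ : q₀ ≤ Q := integral_log_sq_le_integral_norm_sq hs hx
  have hQ0 : 0 < Q := lt_of_lt_of_le hq₀ hqQ
  set A : ℝ := c₁ * x ^ (ρ₀.re + 1 / 2) / (1 + |t|) ^ 2 with hAdef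
  have hA0 : 0 ≤ A := by positivity
  have h1 : A ≤ B * P + 1 := firstMoment_ineq hζ hβ t (by linarith)
  have h2 : ∀ lam : ℝ, 0 < lam → P ≤ lam * x / 2 + Q / (2 * lam) := fun lam hlam ↦
    (integral_norm_le_amgm hs (by linarith) hlam).trans (by gcongr; linarith)
  have hclaim := sq_le_of_firstMoment hA0 (by norm_num) hx0 hQ0 hq₀ (by nlinarith) h1 h2
  -- unpack `A²`
  have hA2 : A ^ 2 = c₁ ^ 2 * x * x ^ (2 * ρ₀.re) / (1 + |t|) ^ 4 := by
    rw [hAdef, div_pow, mul_pow, ← Real.rpow_natCast (x ^ (ρ₀.re + 1 / 2)) 2,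
      ← Real.rpow_mul hx0.le, show (ρ₀.re + 1 / 2) * ((2 : ℕ) : ℝ) = 2 * ρ₀.re + 1 by push_cast; ring,
      Real.rpow_add_one hx0.ne']
    ring
  have hmain : x ^ (2 * ρ₀.re) / (1 + |t|) ^ 4 ≤ K / c₁ ^ 2 * Q := by
    rw [hA2] at hclaim
    rw [div_mul_eq_mul_div, le_div_iff₀ (by positivity)]
    have h' : x ^ (2 * ρ₀.re) / (1 + |t|) ^ 4 * c₁ ^ 2 * x ≤ K * Q * x := by
      calc x ^ (2 * ρ₀.re) / (1 + |t|) ^ 4 * c₁ ^ 2 * x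
          = c₁ ^ 2 * x * x ^ (2 * ρ₀.re) / (1 + |t|) ^ 4 := by ring
        _ ≤ max (4 * B ^ 2) (2 / q₀) * x * Q := hclaim
        _ = K * Q * x := by rw [hK]; ring
    exact le_of_mul_le_mul_right h' hx0
  have hsecond : 1 / x ≤ 1 / (2 * q₀) * Q := by
    rw [div_le_iff₀ hx0]
    calc (1 : ℝ) = 1 / (2 * q₀) * (2 * q₀) := by field_simp
      _ ≤ 1 / (2 * q₀) * (Q * x) :=
          mul_le_mul_of_nonneg_left (by nlinarith) (by positivity)
      _ = 1 / (2 * q₀) * Q * x := by ring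
  have hden : 0 < K / c₁ ^ 2 + 1 / (2 * q₀) := by positivity
  rw [div_mul_eq_mul_div, one_mul, div_le_iff₀ hden]
  calc x ^ (2 * ρ₀.re) / (1 + |t|) ^ 4 + 1 / x ≤ K / c₁ ^ 2 * Q + 1 / (2 * q₀) * Q :=
        add_le_add hmain hsecond
    _ = Q * (K / c₁ ^ 2 + 1 / (2 * q₀)) := by ring

/-- **Bettin–Gonek 2017, Theorem 1, discharged**: the fact `BettinGonek2017_thm1` of
`MollifierLimitations.lean` holds. [cite: BettinGonek2017, Theorem 1] -/
theorem BettinGonek2017_thm1_holds : BettinGonek2017_thm1 :=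
  BettinGonek2017_thm1_of_lowerBound BettinGonek2017_lowerBound_holds

/-- Bettin–Gonek's printed corollary, now unconditional in its analytic input: the θ = ∞-type
moment hypothesis for arbitrarily large `θ` implies the Riemann hypothesis.
[cite: BettinGonek2017, Theorem 1] -/
theorem riemannHypothesis_of_mollifiedSecondMoment_bound
    (hyp : ∀ θ : ℝ, 0 < θ → ∀ ε : ℝ, 0 < ε → ∃ C : ℝ, ∀ T : ℝ, 2 ≤ T → ∀ N : ℕ, 2 ≤ N →
      (N : ℝ) ≤ T ^ θ → mollifiedSecondMoment N 0 T ≤ C * T ^ (1 + ε)) :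
    RiemannHypothesis :=
  BettinGonek2017_thm1.riemannHypothesis BettinGonek2017_thm1_holds hyp

/-- **The barrier `MollifierLimitations` from Radziwiłł's three printed inputs alone** (the
Bettin–Gonek conjunct being proved): Proposition A, Lemma 5 and Proposition B of Radziwiłł 2012
imply `MollifierLimitations`. [cite: Radziwill2012, §4] [cite: BettinGonek2017, Theorem 1] -/
theorem MollifierLimitations_of_radziwill_inputs (hA : Radziwill2012_propA)
    (h5 : Radziwill2012_lemma5) (hB : Radziwill2012_propB) : MollifierLimitations :=
  ⟨Radziwill2012_thm1_of_inputs hA h5 hB, BettinGonek2017_thm1_holds⟩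

end Literature.Barriers.RiemannHypothesis
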